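/-
Copyright (c) 2026 the pub-hodgecm-mathlib formalisation cell (harness21).  Prover seat hodgecm-mathlib-K2E4-p10 (g9), Track B «K2-LIT»,
#184♮ = hLiu418 = `stmt-HodgeConjecture-24832`; socket #41, KIND W, (x-b) of LEAD F0P6-plan (g14) BATCH #62 (1) + desk K2E5-p17 RULING 2026-09-04T22:32:19Z («(β)»).
FILE 2d of this seat's (x-b) chain: the INDEX DICTIONARY between the Fourier index `S ∈ M_n(L)` and its frame-conjugated archimedean images `x_σ = A_σ·σ(S)·B_σ`
(the junction's normalised index at a complex place), for the instantiation of ★ `K2LiuSiegelEisensteinKindWArchBlock.archGrowth_le_heightDecay` (LH4-p08 (g11)) into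
★ `K2LiuSiegelEisensteinKindWPresentation.dloc_of_presentation`'s `harch`.  THEOREMS ONLY (no `def`, no `instance`, no notation, no named-fact hypothesis, no `sorry`).
-/
import Summits.HodgeConjecture.HodgeConjecture.Theorems.K2LiuSiegelEisensteinKindWDecay     -- ★ p862527 (this seat): `apply_entry_le_norm`, `apply_det_le`
import Summits.HodgeConjecture.HodgeConjecture.Theorems.K2LiuArchBlockHeightBound            -- ★ G7-B: `norm_apply_le_re_trace_of_posDef`, `norm_mul_apply_le`
import HarnessLib

/-!
# Crux `HLiu418`, socket #41, KIND W — `K2LiuSiegelEisensteinKindWIndexDictionary`: THE INDEX DICTIONARY `S ↔ x_σ = A_σ·σ(S)·B_σ` —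
# size (`τ S` against `Σ_σ Re tr x_σ`, two-sided), determinant (`|det x_σ|` against `|det S|_{w σ}`), and the block → place defect transfer

Cell `hodgecm-mathlib`, crux item hLiu418 = `stmt-HodgeConjecture-24832` (helper lane `--supports … --as helper`, count-neutral), route of record `HCCMUnconditional`;
squad K2 ∕ K2Liu, road `K2_Liu`, socket #41 `sig_K2LiuSiegelEisensteinContinuation`, KIND W.  ★ `K2LiuSiegelEisensteinKindWArchBlock.archGrowth_le_heightDecay` turns the
junction's three-factor archimedean growth at the Iwasawa-normalised index `h′_σ = y_σᴴ x_σ y_σ` into the height currency, for indices `x_σ ≻ 0` and a size `τ` with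
`τ ≤ Σ_σ Re tr x_σ ≤ K τ`, with the determinant DEFECT in BLOCK currency `∏_σ (1 + (Re det x_σ)⁻¹)^{N′₁}`; ★ STAGE 2 `dloc_of_presentation` wants the arch letter with the
TOP's size `τ S = ‖(ι_∞ S_{ab})_{ab}‖` and the defect in PLACE currency `∏_{w∣∞} (1 + |det S|_w⁻¹)^{N′}`.  The instantiation reads `x_σ` off the Fourier index
`S ∈ M_n(L)` through a complex embedding `φ_σ : L →+* ℂ` and fixed invertible frame matrices: `x_σ = A_σ · S^{φ_σ} · B_σ` (the pairing `ψ(tr(S X))` in the tube frame).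
THIS FILE is the dictionary between the two currencies, GENERIC in the frames (BY VALUE: `φ`, `A B Ainv Binv` with `A·Ainv = 1 = Binv·B`… and one bound `M_f ≥ 1` on
their entries; `hcover`: every infinite place of `L` is some `mk φ_σ`):
* §1 size: `norm_entry_frameConj_le` (`‖(x_σ)_{ab}‖ ≤ n² M_f² τ S`), `re_trace_frameConj_le`, **`sum_re_trace_frameConj_le`** (`Σ_σ Re tr x_σ ≤ #S·n·n²M_f²·τ S`);
  **`tau_le_sum_re_trace_frameConj`** (`x_σ ≻ 0` at every `σ` ⟹ `τ S ≤ n² M_f² · Σ_σ Re tr x_σ`, ★ G7-B `norm_apply_le_re_trace_of_posDef` and `hcover`);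
* §2 determinant: `norm_det_frameConj` (`‖det x_σ‖ = ‖det A_σ‖·‖det B_σ‖·|det S|_{mk φ_σ}`), **`inv_re_det_frameConj_le`** (`x_σ ≻ 0` ⟹ `(Re det x_σ)⁻¹ ≤ ‖det Ainv_σ‖‖det Binv_σ‖·|det S|_{mk φ_σ}⁻¹`);
* §3 defect transfer: `prod_one_add_mul_le` and **`prod_block_defect_le_prod_place_defect`** (`∏_σ (1 + (Re det x_σ)⁻¹)^{N} ≤ C^{N·#S} · ∏_{w∣∞} (1 + |det S|_w⁻¹)^{N·#S}`).
* §4 (edition 2, additions only) THE INDEFINITE TWINS — no positivity of `x_σ` (for ★ `K2LiuSiegelEisensteinKindWArchBlockIndefinite`, LH4-p08 (g11), entry-sum ∕ `‖det‖⁻¹`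
  currencies): **`norm_embedding_entry_le_sum_norm_frameConj`** (`‖φ_σ(S_{ab})‖ ≤ M_f² Σ_{cd} ‖(x_σ)_{cd}‖`), **`tau_le_sum_norm_entry_frameConj`** (`τ S ≤ M_f²·Σ_σ Σ_{cd}‖(x_σ)_{cd}‖`),
  **`sum_norm_entry_frameConj_le`** (`Σ_σ Σ_{cd} ‖(x_σ)_{cd}‖ ≤ #S·n²·n²M_f²·τ S`), `inv_norm_det_frameConj` (`‖det x_σ‖⁻¹ = ‖det Ainv_σ‖‖det Binv_σ‖·|det S|_{mk φ_σ}⁻¹`),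
  **`prod_block_normDefect_le_prod_place_defect`** (`∏_σ (1 + ‖det x_σ‖⁻¹)^{N} ≤ C^{N·#S} · ∏_{w∣∞} (1 + |det S|_w⁻¹)^{N·#S}`).
[MoeglinWaldspurger1995, I.2.2, IV.1.9], [Shimura1997, §18.1 (18.4), §A3], [Shimura1982, §1 (1.25)], [BorelJacquet1979, §1.2].
HONEST LABEL.  Count-neutral helper, closes no socket: `HC_CM` is proved only modulo the 7 printed citations (2 remaining named inputs: hLiu418 =
`stmt-HodgeConjecture-24832`, h413 = `stmt-HodgeConjecture-24833`) until rung 0 closes.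
-/

set_option autoImplicit false
set_option linter.dupNamespace false -- the mandated namespace repeats `HodgeConjecture.HodgeConjecture`

noncomputable section

namespace Summit.HodgeConjecture.HodgeConjecture.Cruxes.HLiu418.K2LiuSiegelEisensteinKindWIndexDictionary

open scoped BigOperators NNReal ComplexOrder Matrix
-- `Classical` is needed to see the Mathlib normed-ring instances on `mixedSpace L` (note H5 of ★ `AdelicGLnGlue`)
open scoped Classical
open NumberField NumberField.mixedEmbedding NumberField.InfinitePlace
open Summit.HodgeConjecture.HodgeConjecture.Cruxes.HLiu418.K2LiuSiegelEisensteinKindWDecay (apply_entry_le_norm)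
open Summit.HodgeConjecture.HodgeConjecture.Cruxes.HLiu418.K2LiuArchBlockHeightBound (norm_apply_le_re_trace_of_posDef norm_mul_apply_le norm_det_le_of_entry_le)

variable (L : Type) [Field L] [NumberField L] {n : ℕ} {Sinf : Type*} [Fintype Sinf]

/-! ## §1 Size: `τ S` against the traces of the frame-conjugated indices -/

section Size

variable (φ : Sinf → (L →+* ℂ)) (A B : Sinf → Matrix (Fin n) (Fin n) ℂ) {Mf : ℝ} (hMf : 1 ≤ Mf)
  (hA : ∀ σ i j, ‖A σ i j‖ ≤ Mf) (hB : ∀ σ i j, ‖B σ i j‖ ≤ Mf)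

omit [Fintype Sinf] in
/-- the embedded entries are below the TOP's size: `‖φ_σ(S_{ab})‖ ≤ τ S = ‖(ι_∞ S_{ab})_{ab}‖` (★ `apply_entry_le_norm` at the place `mk φ_σ`).
[cite: BorelJacquet1979, §1.2] -/
theorem norm_embedding_entry_le (σ : Sinf) (S : Matrix (Fin n) (Fin n) L) (a b : Fin n) :
    ‖φ σ (S a b)‖ ≤ ‖fun a b => mixedEmbedding L (S a b)‖ := by
  rw [← InfinitePlace.apply]
  exact apply_entry_le_norm L (InfinitePlace.mk (φ σ)) S a b

include hMf hA hB in
omit [Fintype Sinf] in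
/-- **entries of `x_σ = A_σ·S^{φ_σ}·B_σ`**: `‖(x_σ)_{ab}‖ ≤ n²·M_f²·τ S`. [cite: BorelJacquet1979, §1.2] -/
theorem norm_entry_frameConj_le (σ : Sinf) (S : Matrix (Fin n) (Fin n) L) (a b : Fin n) :
    ‖(A σ * (S.map (φ σ)) * B σ) a b‖ ≤ (n : ℝ) ^ 2 * Mf ^ 2 * ‖fun a b => mixedEmbedding L (S a b)‖ := by
  set τ : ℝ := ‖fun a b => mixedEmbedding L (S a b)‖ with hτ
  have hτ0 : 0 ≤ τ := norm_nonneg _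
  have hM0 : 0 ≤ Mf := zero_le_one.trans hMf
  have h1 : ∀ i j, ‖(A σ * S.map (φ σ)) i j‖ ≤ (Fintype.card (Fin n) : ℝ) * (Mf * τ) := fun i j =>
    norm_mul_apply_le hM0 (hA σ) (fun i j => by rw [Matrix.map_apply]; exact norm_embedding_entry_le L φ σ S i j) i j
  have h2 := norm_mul_apply_le (by positivity) h1 (hB σ) a b
  rw [Fintype.card_fin] at h2
  calc ‖(A σ * S.map (φ σ) * B σ) a b‖ ≤ (n : ℝ) * ((n : ℝ) * (Mf * τ) * Mf) := h2
    _ = (n : ℝ) ^ 2 * Mf ^ 2 * τ := by ring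

include hMf hA hB in
omit [Fintype Sinf] in
/-- `Re tr x_σ ≤ n·n²M_f²·τ S`. [cite: BorelJacquet1979, §1.2] -/
theorem re_trace_frameConj_le (σ : Sinf) (S : Matrix (Fin n) (Fin n) L) :
    ((A σ * (S.map (φ σ)) * B σ).trace).re ≤ (n : ℝ) * ((n : ℝ) ^ 2 * Mf ^ 2 * ‖fun a b => mixedEmbedding L (S a b)‖) := by
  rw [Matrix.trace, Complex.re_sum]
  calc ∑ i, ((A σ * (S.map (φ σ)) * B σ).diag i).re ≤ ∑ _i : Fin n, (n : ℝ) ^ 2 * Mf ^ 2 * ‖fun a b => mixedEmbedding L (S a b)‖ :=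
        Finset.sum_le_sum fun i _ => (Complex.re_le_norm _).trans (norm_entry_frameConj_le L φ A B hMf hA hB σ S i i)
    _ = (n : ℝ) * ((n : ℝ) ^ 2 * Mf ^ 2 * ‖fun a b => mixedEmbedding L (S a b)‖) := by rw [Finset.sum_const, Finset.card_univ, Fintype.card_fin, nsmul_eq_mul]

include hMf hA hB in
/-- **`Σ_σ Re tr x_σ ≤ #S·n·n²M_f²·τ S`** (the upper half of ★ `archGrowth_le_heightDecay`'s comparison `Σ_σ Re tr x_σ ≤ K·τ`). [cite: MoeglinWaldspurger1995, I.2.2] -/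
theorem sum_re_trace_frameConj_le (S : Matrix (Fin n) (Fin n) L) :
    ∑ σ, ((A σ * (S.map (φ σ)) * B σ).trace).re ≤ (Fintype.card Sinf : ℝ) * ((n : ℝ) * ((n : ℝ) ^ 2 * Mf ^ 2 * ‖fun a b => mixedEmbedding L (S a b)‖)) := by
  calc ∑ σ, ((A σ * (S.map (φ σ)) * B σ).trace).re ≤ ∑ _σ : Sinf, (n : ℝ) * ((n : ℝ) ^ 2 * Mf ^ 2 * ‖fun a b => mixedEmbedding L (S a b)‖) :=
        Finset.sum_le_sum fun σ _ => re_trace_frameConj_le L φ A B hMf hA hB σ S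
    _ = _ := by rw [Finset.sum_const, Finset.card_univ, nsmul_eq_mul]

variable (Ainv Binv : Sinf → Matrix (Fin n) (Fin n) ℂ) (hAi : ∀ σ, Ainv σ * A σ = 1) (hBi : ∀ σ, B σ * Binv σ = 1)
  (hAe : ∀ σ i j, ‖Ainv σ i j‖ ≤ Mf) (hBe : ∀ σ i j, ‖Binv σ i j‖ ≤ Mf)
  (hcover : ∀ w : InfinitePlace L, ∃ σ, InfinitePlace.mk (φ σ) = w)

include hAi hBi in
omit [Fintype Sinf] in
omit [NumberField L] in
/-- recovering the embedded index: `S^{φ_σ} = Ainv_σ · x_σ · Binv_σ`. [folklore] -/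
theorem map_eq_frameConj_inv (σ : Sinf) (S : Matrix (Fin n) (Fin n) L) :
    S.map (φ σ) = Ainv σ * (A σ * (S.map (φ σ)) * B σ) * Binv σ := by
  rw [← Matrix.mul_assoc, ← Matrix.mul_assoc, hAi, Matrix.one_mul, Matrix.mul_assoc, hBi, Matrix.mul_one]

include hMf hAi hBi hAe hBe in
omit [NumberField L] [Fintype Sinf] in
/-- **an embedded entry against the trace of a positive index**: `x_σ ≻ 0` ⟹ `‖φ_σ(S_{ab})‖ ≤ n²M_f²·Re tr x_σ` (★ G7-B `norm_apply_le_re_trace_of_posDef`).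
[cite: Shimura1997, §A3] -/
theorem norm_embedding_entry_le_re_trace (σ : Sinf) (S : Matrix (Fin n) (Fin n) L) (hx : (A σ * (S.map (φ σ)) * B σ).PosDef) (a b : Fin n) :
    ‖φ σ (S a b)‖ ≤ (n : ℝ) ^ 2 * Mf ^ 2 * ((A σ * (S.map (φ σ)) * B σ).trace).re := by
  set x : Matrix (Fin n) (Fin n) ℂ := A σ * (S.map (φ σ)) * B σ with hxdef
  have hM0 : 0 ≤ Mf := zero_le_one.trans hMf
  have htr0 : 0 ≤ (x.trace).re := by
    by_cases hn : n = 0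
    · subst hn; simp [Matrix.trace]
    · obtain ⟨i⟩ : Nonempty (Fin n) := Fin.pos_iff_nonempty.1 (Nat.pos_of_ne_zero hn)
      exact (norm_nonneg _).trans (norm_apply_le_re_trace_of_posDef hx i i)
  have hentry : (S.map (φ σ)) a b = (Ainv σ * x * Binv σ) a b := by rw [← map_eq_frameConj_inv L φ A B Ainv Binv hAi hBi σ S]
  have h1 : ∀ i j, ‖(Ainv σ * x) i j‖ ≤ (Fintype.card (Fin n) : ℝ) * (Mf * (x.trace).re) := fun i j =>
    norm_mul_apply_le hM0 (hAe σ) (fun i j => norm_apply_le_re_trace_of_posDef hx i j) i j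
  have h2 := norm_mul_apply_le (by positivity) h1 (hBe σ) a b
  rw [Fintype.card_fin] at h2
  rw [show φ σ (S a b) = (S.map (φ σ)) a b from (Matrix.map_apply).symm, hentry]
  calc ‖(Ainv σ * x * Binv σ) a b‖ ≤ (n : ℝ) * ((n : ℝ) * (Mf * (x.trace).re) * Mf) := h2
    _ = (n : ℝ) ^ 2 * Mf ^ 2 * (x.trace).re := by ring

include hMf hAi hBi hAe hBe hcover in
/-- **`τ S ≤ n² M_f² · Σ_σ Re tr x_σ` WHEN EVERY `x_σ ≻ 0`** (the lower half of ★ `archGrowth_le_heightDecay`'s comparison, at `τ := τ S`): the TOP's size is the sup over the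
infinite places `w` and the entries of `|S_{ab}|_w`, every `w` is some `mk φ_σ` (`hcover`), and at `σ` the entry is below `n²M_f²·Re tr x_σ ≤ n²M_f²·Σ`.
[cite: MoeglinWaldspurger1995, I.2.2] [cite: Shimura1997, §A3] -/
theorem tau_le_sum_re_trace_frameConj (S : Matrix (Fin n) (Fin n) L) (hx : ∀ σ, (A σ * (S.map (φ σ)) * B σ).PosDef) :
    ‖fun a b => mixedEmbedding L (S a b)‖ ≤ (n : ℝ) ^ 2 * Mf ^ 2 * ∑ σ, ((A σ * (S.map (φ σ)) * B σ).trace).re := by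
  have htr0 : ∀ σ, 0 ≤ ((A σ * (S.map (φ σ)) * B σ).trace).re := fun σ => by
    by_cases hn : n = 0
    · subst hn; simp [Matrix.trace]
    · obtain ⟨i⟩ : Nonempty (Fin n) := Fin.pos_iff_nonempty.1 (Nat.pos_of_ne_zero hn)
      exact (norm_nonneg _).trans (norm_apply_le_re_trace_of_posDef (hx σ) i i)
  have hsum0 : 0 ≤ (n : ℝ) ^ 2 * Mf ^ 2 * ∑ σ, ((A σ * (S.map (φ σ)) * B σ).trace).re := by
    have : 0 ≤ ∑ σ, ((A σ * (S.map (φ σ)) * B σ).trace).re := Finset.sum_nonneg fun σ _ => htr0 σ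
    positivity
  -- the sup norm over the entries and the places
  refine (pi_norm_le_iff_of_nonneg hsum0).2 fun a => (pi_norm_le_iff_of_nonneg hsum0).2 fun b => ?_
  rw [norm_eq_sup'_normAtPlace]
  refine Finset.sup'_le _ _ fun w _ => ?_
  rw [normAtPlace_apply]
  obtain ⟨σ, hσ⟩ := hcover w
  rw [← hσ, InfinitePlace.apply]
  calc ‖φ σ (S a b)‖ ≤ (n : ℝ) ^ 2 * Mf ^ 2 * ((A σ * (S.map (φ σ)) * B σ).trace).re :=
        norm_embedding_entry_le_re_trace L φ A B hMf Ainv Binv hAi hBi hAe hBe σ S (hx σ) a b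
    _ ≤ (n : ℝ) ^ 2 * Mf ^ 2 * ∑ σ', ((A σ' * (S.map (φ σ')) * B σ').trace).re :=
        mul_le_mul_of_nonneg_left (Finset.single_le_sum (fun σ' _ => htr0 σ') (Finset.mem_univ σ)) (by positivity)

end Size

/-! ## §2 Determinant: `|det x_σ|` against `|det S|_{w σ}` -/

section Det

variable (φ : Sinf → (L →+* ℂ)) (A B Ainv Binv : Sinf → Matrix (Fin n) (Fin n) ℂ) (hAi : ∀ σ, Ainv σ * A σ = 1) (hBi : ∀ σ, B σ * Binv σ = 1)

omit [NumberField L] [Fintype Sinf] in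
/-- **`‖det x_σ‖ = ‖det A_σ‖·‖det B_σ‖·|det S|_{mk φ_σ}`** (`det` of a product; `φ_σ(det S) = det S^{φ_σ}`). [cite: Shimura1997, §18.1 (18.4)] -/
theorem norm_det_frameConj (σ : Sinf) (S : Matrix (Fin n) (Fin n) L) :
    ‖(A σ * (S.map (φ σ)) * B σ).det‖ = ‖(A σ).det‖ * ‖(B σ).det‖ * (InfinitePlace.mk (φ σ)) S.det := by
  rw [Matrix.det_mul, Matrix.det_mul, norm_mul, norm_mul, InfinitePlace.apply, RingHom.map_det, RingHom.mapMatrix_apply]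
  ring

include hAi hBi in
omit [NumberField L] [Fintype Sinf] in
/-- **`(Re det x_σ)⁻¹ ≤ ‖det Ainv_σ‖·‖det Binv_σ‖·|det S|_{mk φ_σ}⁻¹` when `x_σ ≻ 0`** (then `Re det x_σ = ‖det x_σ‖ > 0`; `‖det A_σ‖⁻¹ = ‖det Ainv_σ‖`).
[cite: Shimura1997, §18.1 (18.4)] [cite: BorelJacquet1979, §1.2] -/
theorem inv_re_det_frameConj_le (σ : Sinf) (S : Matrix (Fin n) (Fin n) L) (hx : (A σ * (S.map (φ σ)) * B σ).PosDef) :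
    (((A σ * (S.map (φ σ)) * B σ).det).re)⁻¹ ≤ ‖(Ainv σ).det‖ * ‖(Binv σ).det‖ * ((InfinitePlace.mk (φ σ)) S.det)⁻¹ := by
  set x : Matrix (Fin n) (Fin n) ℂ := A σ * (S.map (φ σ)) * B σ with hxdef
  -- `Re det x = ‖det x‖` for `x ≻ 0`
  have hdetpos : 0 < x.det := hx.det_pos
  have hre : (x.det).re = ‖x.det‖ := by
    obtain ⟨hr, hi⟩ := Complex.pos_iff.1 hdetpos
    rw [← Complex.re_add_im x.det, ← hi]
    simp [abs_of_pos hr]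
  rw [hre, hxdef, norm_det_frameConj L φ A B σ S]
  -- `‖det A‖⁻¹ = ‖det Ainv‖`, `‖det B‖⁻¹ = ‖det Binv‖`
  have hA1 : (Ainv σ).det * (A σ).det = 1 := by rw [← Matrix.det_mul, hAi, Matrix.det_one]
  have hB1 : (B σ).det * (Binv σ).det = 1 := by rw [← Matrix.det_mul, hBi, Matrix.det_one]
  have hAn : ‖(A σ).det‖⁻¹ = ‖(Ainv σ).det‖ := by
    rw [← norm_inv]; congr 1; exact inv_eq_of_mul_eq_one_left hA1
  have hBn : ‖(B σ).det‖⁻¹ = ‖(Binv σ).det‖ := by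
    rw [← norm_inv]; congr 1; exact inv_eq_of_mul_eq_one_right hB1
  rw [mul_inv, mul_inv, hAn, hBn]

end Det

/-! ## §3 The defect transfer: block places to infinite places -/

section Transfer

/-- `∏_{σ} (1 + C·u(g σ))^N ≤ (max 1 C)^{N·#S} · (∏_{w} (1 + u w))^{N·#S}` for `u ≥ 0` and any `g : S → W` into a finite type (each factor `1 + C u(g σ) ≤ (max 1 C)(1 + u(g σ))
≤ (max 1 C) ∏_w (1 + u w)`). [folklore] -/
theorem prod_one_add_mul_pow_le {S W : Type*} [Fintype S] [Fintype W] (g : S → W) (u : W → ℝ) (hu : ∀ w, 0 ≤ u w) {C : ℝ} (hC : 0 ≤ C) (N : ℕ) :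
    ∏ σ, (1 + C * u (g σ)) ^ N ≤ (max 1 C) ^ (N * Fintype.card S) * (∏ w, (1 + u w)) ^ (N * Fintype.card S) := by
  have hP1 : 1 ≤ ∏ w, (1 + u w) := by
    calc (1 : ℝ) = ∏ _w : W, (1 : ℝ) := Finset.prod_const_one.symm
      _ ≤ ∏ w, (1 + u w) := Finset.prod_le_prod (fun _ _ => zero_le_one) fun w _ => le_add_of_nonneg_right (hu w)
  have hfac : ∀ σ, 1 + C * u (g σ) ≤ max 1 C * ∏ w, (1 + u w) := by
    intro σ
    have h1 : 1 + C * u (g σ) ≤ max 1 C * (1 + u (g σ)) := by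
      rw [mul_add, mul_one]
      exact add_le_add (le_max_left 1 C) (mul_le_mul_of_nonneg_right (le_max_right 1 C) (hu _))
    have h2 : 1 + u (g σ) ≤ ∏ w, (1 + u w) := by
      rw [← Finset.mul_prod_erase Finset.univ (fun w => 1 + u w) (Finset.mem_univ (g σ))]
      have h3 : 1 ≤ ∏ w ∈ Finset.univ.erase (g σ), (1 + u w) := by
        calc (1 : ℝ) = ∏ _w ∈ Finset.univ.erase (g σ), (1 : ℝ) := Finset.prod_const_one.symm
          _ ≤ _ := Finset.prod_le_prod (fun _ _ => zero_le_one) fun w _ => le_add_of_nonneg_right (hu w)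
      exact le_mul_of_one_le_right (by linarith [hu (g σ)]) h3
    exact h1.trans (mul_le_mul_of_nonneg_left h2 (le_trans zero_le_one (le_max_left 1 C)))
  calc ∏ σ, (1 + C * u (g σ)) ^ N ≤ ∏ _σ : S, (max 1 C * ∏ w, (1 + u w)) ^ N :=
        Finset.prod_le_prod (fun σ _ => pow_nonneg (by nlinarith [hu (g σ), hC]) _) fun σ _ => pow_le_pow_left₀ (by nlinarith [hu (g σ), hC]) (hfac σ) N
    _ = (max 1 C * ∏ w, (1 + u w)) ^ (N * Fintype.card S) := by rw [Finset.prod_const, Finset.card_univ, ← pow_mul]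
    _ = (max 1 C) ^ (N * Fintype.card S) * (∏ w, (1 + u w)) ^ (N * Fintype.card S) := mul_pow _ _ _

variable (φ : Sinf → (L →+* ℂ)) (A B Ainv Binv : Sinf → Matrix (Fin n) (Fin n) ℂ) (hAi : ∀ σ, Ainv σ * A σ = 1) (hBi : ∀ σ, B σ * Binv σ = 1)

include hAi hBi in
/-- **THE DEFECT TRANSFER**: with `C_d := max_σ ‖det Ainv_σ‖‖det Binv_σ‖` (any common bound `Cd`), for every `S` with all `x_σ ≻ 0`:
`∏_σ (1 + (Re det x_σ)⁻¹)^{N} ≤ (max 1 C_d)^{N·#S} · (∏_{w∣∞} (1 + |det S|_w⁻¹))^{N·#S}` — ★ `archGrowth_le_heightDecay`'s block defect against ★ `hdec_of_letters`' place defect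
(exponent `N′ := N·#S`; `(∏_w f_w)^{m} = ∏_w f_w^{m}`). [cite: MoeglinWaldspurger1995, IV.1.9] [cite: Shimura1997, §18.1 (18.4)] -/
theorem prod_block_defect_le_prod_place_defect {Cd : ℝ} (hCd0 : 0 ≤ Cd) (hCd : ∀ σ, ‖(Ainv σ).det‖ * ‖(Binv σ).det‖ ≤ Cd) (S : Matrix (Fin n) (Fin n) L)
    (hx : ∀ σ, (A σ * (S.map (φ σ)) * B σ).PosDef) (N : ℕ) :
    ∏ σ, (1 + (((A σ * (S.map (φ σ)) * B σ).det).re)⁻¹) ^ N ≤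
      (max 1 Cd) ^ (N * Fintype.card Sinf) * ∏ w : InfinitePlace L, (1 + (w S.det)⁻¹) ^ (N * Fintype.card Sinf) := by
  -- each block factor against the place factor at `w = mk φ_σ`
  have hle : ∀ σ, (1 + (((A σ * (S.map (φ σ)) * B σ).det).re)⁻¹) ^ N ≤ (1 + Cd * ((InfinitePlace.mk (φ σ)) S.det)⁻¹) ^ N := fun σ => by
    have hdetpos : 0 < (((A σ * (S.map (φ σ)) * B σ).det).re) := (Complex.pos_iff.1 (hx σ).det_pos).1
    have hh : (((A σ * (S.map (φ σ)) * B σ).det).re)⁻¹ ≤ Cd * ((InfinitePlace.mk (φ σ)) S.det)⁻¹ :=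
      (inv_re_det_frameConj_le L φ A B Ainv Binv hAi hBi σ S (hx σ)).trans
        (mul_le_mul_of_nonneg_right (hCd σ) (inv_nonneg.2 (apply_nonneg _ _)))
    exact pow_le_pow_left₀ (add_nonneg zero_le_one (inv_nonneg.2 hdetpos.le)) (by linarith) N
  calc ∏ σ, (1 + (((A σ * (S.map (φ σ)) * B σ).det).re)⁻¹) ^ N ≤ ∏ σ, (1 + Cd * ((InfinitePlace.mk (φ σ)) S.det)⁻¹) ^ N :=
        Finset.prod_le_prod (fun σ _ => pow_nonneg (add_nonneg zero_le_one (inv_nonneg.2 (Complex.pos_iff.1 (hx σ).det_pos).1.le)) _) fun σ _ => hle σ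
    _ ≤ (max 1 Cd) ^ (N * Fintype.card Sinf) * (∏ w : InfinitePlace L, (1 + (w S.det)⁻¹)) ^ (N * Fintype.card Sinf) :=
        prod_one_add_mul_pow_le (fun σ => InfinitePlace.mk (φ σ)) (fun w => (w S.det)⁻¹) (fun w => inv_nonneg.2 (apply_nonneg _ _)) hCd0 N
    _ = (max 1 Cd) ^ (N * Fintype.card Sinf) * ∏ w : InfinitePlace L, (1 + (w S.det)⁻¹) ^ (N * Fintype.card Sinf) := by rw [Finset.prod_pow]

end Transfer

/-! ## §4 (edition 2, additions only) The indefinite twins: entry-sum currency for the size, `‖det x_σ‖⁻¹` currency for the defect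

★ `K2LiuSiegelEisensteinKindWArchBlock.archGrowth_le_heightDecay` and §1–§3 serve indices with every `x_σ ≻ 0`.  At an INDEFINITE index the archimedean letter decays in the
trace norm of `y_σᴴ x_σ y_σ` (Shimura's `τ`, `μ` of the twisted index), and the consumer-side twin ★ `K2LiuSiegelEisensteinKindWArchBlockIndefinite` (LH4-p08) is purely
metric: its size comparison is `τ ≤ Σ_σ Σ_{ab} ‖(x_σ)_{ab}‖ ≤ K τ` and its defect is `∏_σ (1 + ‖det x_σ‖⁻¹)^{N′₁}`.  The dictionary in those currencies needs NO positivity. -/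

section Indefinite

variable (φ : Sinf → (L →+* ℂ)) (A B Ainv Binv : Sinf → Matrix (Fin n) (Fin n) ℂ) {Mf : ℝ}

omit [NumberField L] [Fintype Sinf] in
/-- **an embedded entry against the entries of the frame-conjugated index, no positivity**: `‖φ_σ(S_{ab})‖ ≤ M_f² · Σ_{c,d} ‖(x_σ)_{cd}‖`
(`S^{φ_σ} = Ainv_σ·x_σ·Binv_σ`, entries of `Ainv_σ`, `Binv_σ` at most `M_f`). [cite: BorelJacquet1979, §1.2] -/
theorem norm_embedding_entry_le_sum_norm_frameConj (hMf : 1 ≤ Mf) (hAi : ∀ σ, Ainv σ * A σ = 1) (hBi : ∀ σ, B σ * Binv σ = 1)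
    (hAe : ∀ σ i j, ‖Ainv σ i j‖ ≤ Mf) (hBe : ∀ σ i j, ‖Binv σ i j‖ ≤ Mf) (σ : Sinf) (S : Matrix (Fin n) (Fin n) L) (a b : Fin n) :
    ‖φ σ (S a b)‖ ≤ Mf ^ 2 * ∑ c, ∑ d, ‖(A σ * (S.map (φ σ)) * B σ) c d‖ := by
  set x : Matrix (Fin n) (Fin n) ℂ := A σ * (S.map (φ σ)) * B σ with hxdef
  have hM0 : 0 ≤ Mf := zero_le_one.trans hMf
  have hentry : φ σ (S a b) = (Ainv σ * x * Binv σ) a b := by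
    rw [show φ σ (S a b) = (S.map (φ σ)) a b from (Matrix.map_apply).symm, ← map_eq_frameConj_inv L φ A B Ainv Binv hAi hBi σ S]
  rw [hentry, Matrix.mul_apply]
  calc ‖∑ d, (Ainv σ * x) a d * Binv σ d b‖ ≤ ∑ d, ‖(Ainv σ * x) a d * Binv σ d b‖ := norm_sum_le _ _
    _ ≤ ∑ d, (∑ c, Mf * ‖x c d‖) * Mf := by
        refine Finset.sum_le_sum fun d _ => ?_
        rw [norm_mul]
        refine mul_le_mul ?_ (hBe σ d b) (norm_nonneg _) (Finset.sum_nonneg fun c _ => mul_nonneg hM0 (norm_nonneg _))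
        rw [Matrix.mul_apply]
        exact (norm_sum_le _ _).trans (Finset.sum_le_sum fun c _ => by
          rw [norm_mul]; exact mul_le_mul_of_nonneg_right (hAe σ a c) (norm_nonneg _))
    _ = Mf ^ 2 * ∑ d, ∑ c, ‖x c d‖ := by
        rw [Finset.mul_sum]
        refine Finset.sum_congr rfl fun d _ => ?_
        rw [Finset.sum_mul, Finset.mul_sum]
        refine Finset.sum_congr rfl fun c _ => ?_
        ring
    _ = Mf ^ 2 * ∑ c, ∑ d, ‖x c d‖ := by rw [Finset.sum_comm]

omit [Fintype Sinf] in
/-- **`Σ_σ`-free upper face per place**: `Σ_{c,d} ‖(x_σ)_{cd}‖ ≤ n²·(n²M_f²·τ S)` (§1 `norm_entry_frameConj_le` summed over the `n²` entries). [cite: BorelJacquet1979, §1.2] -/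
theorem sum_norm_entry_frameConj_le_place (hMf : 1 ≤ Mf) (hA : ∀ σ i j, ‖A σ i j‖ ≤ Mf) (hB : ∀ σ i j, ‖B σ i j‖ ≤ Mf) (σ : Sinf) (S : Matrix (Fin n) (Fin n) L) :
    ∑ c, ∑ d, ‖(A σ * (S.map (φ σ)) * B σ) c d‖ ≤ (n : ℝ) ^ 2 * ((n : ℝ) ^ 2 * Mf ^ 2 * ‖fun a b => mixedEmbedding L (S a b)‖) := by
  calc ∑ c, ∑ d, ‖(A σ * (S.map (φ σ)) * B σ) c d‖ ≤ ∑ _c : Fin n, ∑ _d : Fin n, (n : ℝ) ^ 2 * Mf ^ 2 * ‖fun a b => mixedEmbedding L (S a b)‖ :=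
        Finset.sum_le_sum fun c _ => Finset.sum_le_sum fun d _ => norm_entry_frameConj_le L φ A B hMf hA hB σ S c d
    _ = (n : ℝ) ^ 2 * ((n : ℝ) ^ 2 * Mf ^ 2 * ‖fun a b => mixedEmbedding L (S a b)‖) := by
        rw [Finset.sum_const, Finset.card_univ, Fintype.card_fin, nsmul_eq_mul, Finset.sum_const, Finset.card_univ, Fintype.card_fin, nsmul_eq_mul]
        ring

/-- **THE UPPER FACE `Σ_σ Σ_{c,d} ‖(x_σ)_{cd}‖ ≤ #S·n²·n²M_f²·τ S`** (the twin of `sum_re_trace_frameConj_le` in entry-sum currency). [cite: MoeglinWaldspurger1995, I.2.2] -/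
theorem sum_norm_entry_frameConj_le (hMf : 1 ≤ Mf) (hA : ∀ σ i j, ‖A σ i j‖ ≤ Mf) (hB : ∀ σ i j, ‖B σ i j‖ ≤ Mf) (S : Matrix (Fin n) (Fin n) L) :
    ∑ σ, ∑ c, ∑ d, ‖(A σ * (S.map (φ σ)) * B σ) c d‖ ≤
      (Fintype.card Sinf : ℝ) * ((n : ℝ) ^ 2 * ((n : ℝ) ^ 2 * Mf ^ 2 * ‖fun a b => mixedEmbedding L (S a b)‖)) := by
  calc ∑ σ, ∑ c, ∑ d, ‖(A σ * (S.map (φ σ)) * B σ) c d‖ ≤ ∑ _σ : Sinf, (n : ℝ) ^ 2 * ((n : ℝ) ^ 2 * Mf ^ 2 * ‖fun a b => mixedEmbedding L (S a b)‖) :=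
        Finset.sum_le_sum fun σ _ => sum_norm_entry_frameConj_le_place L φ A B hMf hA hB σ S
    _ = _ := by rw [Finset.sum_const, Finset.card_univ, nsmul_eq_mul]

/-- **THE LOWER FACE `τ S ≤ M_f² · Σ_σ Σ_{c,d} ‖(x_σ)_{cd}‖`, NO POSITIVITY** (the twin of `tau_le_sum_re_trace_frameConj`): the TOP's size is the sup over the infinite places and
the entries, every place is some `mk φ_σ` (`hcover`), and there `norm_embedding_entry_le_sum_norm_frameConj`. [cite: MoeglinWaldspurger1995, I.2.2] [cite: Shimura1997, §A3] -/
theorem tau_le_sum_norm_entry_frameConj (hMf : 1 ≤ Mf) (hAi : ∀ σ, Ainv σ * A σ = 1) (hBi : ∀ σ, B σ * Binv σ = 1)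
    (hAe : ∀ σ i j, ‖Ainv σ i j‖ ≤ Mf) (hBe : ∀ σ i j, ‖Binv σ i j‖ ≤ Mf) (hcover : ∀ w : InfinitePlace L, ∃ σ, InfinitePlace.mk (φ σ) = w)
    (S : Matrix (Fin n) (Fin n) L) :
    ‖fun a b => mixedEmbedding L (S a b)‖ ≤ Mf ^ 2 * ∑ σ, ∑ c, ∑ d, ‖(A σ * (S.map (φ σ)) * B σ) c d‖ := by
  have h0 : ∀ σ, 0 ≤ ∑ c, ∑ d, ‖(A σ * (S.map (φ σ)) * B σ) c d‖ := fun σ =>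
    Finset.sum_nonneg fun c _ => Finset.sum_nonneg fun d _ => norm_nonneg _
  have hsum0 : 0 ≤ Mf ^ 2 * ∑ σ, ∑ c, ∑ d, ‖(A σ * (S.map (φ σ)) * B σ) c d‖ := by
    have : 0 ≤ ∑ σ, ∑ c, ∑ d, ‖(A σ * (S.map (φ σ)) * B σ) c d‖ := Finset.sum_nonneg fun σ _ => h0 σ
    positivity
  refine (pi_norm_le_iff_of_nonneg hsum0).2 fun a => (pi_norm_le_iff_of_nonneg hsum0).2 fun b => ?_
  rw [norm_eq_sup'_normAtPlace]
  refine Finset.sup'_le _ _ fun w _ => ?_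
  rw [normAtPlace_apply]
  obtain ⟨σ, hσ⟩ := hcover w
  rw [← hσ, InfinitePlace.apply]
  calc ‖φ σ (S a b)‖ ≤ Mf ^ 2 * ∑ c, ∑ d, ‖(A σ * (S.map (φ σ)) * B σ) c d‖ :=
        norm_embedding_entry_le_sum_norm_frameConj L φ A B Ainv Binv hMf hAi hBi hAe hBe σ S a b
    _ ≤ Mf ^ 2 * ∑ σ', ∑ c, ∑ d, ‖(A σ' * (S.map (φ σ')) * B σ') c d‖ :=
        mul_le_mul_of_nonneg_left (Finset.single_le_sum (fun σ' _ => h0 σ') (Finset.mem_univ σ)) (by positivity)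

omit [NumberField L] [Fintype Sinf] in
/-- **`‖det x_σ‖⁻¹ = ‖det Ainv_σ‖·‖det Binv_σ‖·|det S|_{mk φ_σ}⁻¹`** (§2 `norm_det_frameConj`; `‖det A_σ‖⁻¹ = ‖det Ainv_σ‖`), no positivity, an IDENTITY (both sides vanish at
`det S = 0`). [cite: Shimura1997, §18.1 (18.4)] -/
theorem inv_norm_det_frameConj (hAi : ∀ σ, Ainv σ * A σ = 1) (hBi : ∀ σ, B σ * Binv σ = 1) (σ : Sinf) (S : Matrix (Fin n) (Fin n) L) :
    ‖(A σ * (S.map (φ σ)) * B σ).det‖⁻¹ = ‖(Ainv σ).det‖ * ‖(Binv σ).det‖ * ((InfinitePlace.mk (φ σ)) S.det)⁻¹ := by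
  rw [norm_det_frameConj L φ A B σ S]
  have hA1 : (Ainv σ).det * (A σ).det = 1 := by rw [← Matrix.det_mul, hAi, Matrix.det_one]
  have hB1 : (B σ).det * (Binv σ).det = 1 := by rw [← Matrix.det_mul, hBi, Matrix.det_one]
  have hAn : ‖(A σ).det‖⁻¹ = ‖(Ainv σ).det‖ := by
    rw [← norm_inv]; congr 1; exact inv_eq_of_mul_eq_one_left hA1
  have hBn : ‖(B σ).det‖⁻¹ = ‖(Binv σ).det‖ := by
    rw [← norm_inv]; congr 1; exact inv_eq_of_mul_eq_one_right hB1
  rw [mul_inv, mul_inv, hAn, hBn]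

/-- **THE DEFECT TRANSFER IN `‖det‖⁻¹` CURRENCY, NO POSITIVITY**: with a common bound `Cd` of `‖det Ainv_σ‖‖det Binv_σ‖`, for EVERY `S`:
`∏_σ (1 + ‖det x_σ‖⁻¹)^{N} ≤ (max 1 C_d)^{N·#S} · ∏_{w∣∞} (1 + |det S|_w⁻¹)^{N·#S}` (the twin of `prod_block_defect_le_prod_place_defect`).
[cite: MoeglinWaldspurger1995, IV.1.9] [cite: Shimura1997, §18.1 (18.4)] -/
theorem prod_block_normDefect_le_prod_place_defect (hAi : ∀ σ, Ainv σ * A σ = 1) (hBi : ∀ σ, B σ * Binv σ = 1)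
    {Cd : ℝ} (hCd0 : 0 ≤ Cd) (hCd : ∀ σ, ‖(Ainv σ).det‖ * ‖(Binv σ).det‖ ≤ Cd) (S : Matrix (Fin n) (Fin n) L) (N : ℕ) :
    ∏ σ, (1 + ‖(A σ * (S.map (φ σ)) * B σ).det‖⁻¹) ^ N ≤
      (max 1 Cd) ^ (N * Fintype.card Sinf) * ∏ w : InfinitePlace L, (1 + (w S.det)⁻¹) ^ (N * Fintype.card Sinf) := by
  have hle : ∀ σ, (1 + ‖(A σ * (S.map (φ σ)) * B σ).det‖⁻¹) ^ N ≤ (1 + Cd * ((InfinitePlace.mk (φ σ)) S.det)⁻¹) ^ N := fun σ => by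
    have hh : ‖(A σ * (S.map (φ σ)) * B σ).det‖⁻¹ ≤ Cd * ((InfinitePlace.mk (φ σ)) S.det)⁻¹ := by
      rw [inv_norm_det_frameConj L φ A B Ainv Binv hAi hBi σ S]
      exact mul_le_mul_of_nonneg_right (hCd σ) (inv_nonneg.2 (apply_nonneg _ _))
    exact pow_le_pow_left₀ (add_nonneg zero_le_one (inv_nonneg.2 (norm_nonneg _))) (by linarith) N
  calc ∏ σ, (1 + ‖(A σ * (S.map (φ σ)) * B σ).det‖⁻¹) ^ N ≤ ∏ σ, (1 + Cd * ((InfinitePlace.mk (φ σ)) S.det)⁻¹) ^ N :=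
        Finset.prod_le_prod (fun σ _ => pow_nonneg (add_nonneg zero_le_one (inv_nonneg.2 (norm_nonneg _))) _) fun σ _ => hle σ
    _ ≤ (max 1 Cd) ^ (N * Fintype.card Sinf) * (∏ w : InfinitePlace L, (1 + (w S.det)⁻¹)) ^ (N * Fintype.card Sinf) :=
        prod_one_add_mul_pow_le (fun σ => InfinitePlace.mk (φ σ)) (fun w => (w S.det)⁻¹) (fun w => inv_nonneg.2 (apply_nonneg _ _)) hCd0 N
    _ = (max 1 Cd) ^ (N * Fintype.card Sinf) * ∏ w : InfinitePlace L, (1 + (w S.det)⁻¹) ^ (N * Fintype.card Sinf) := by rw [Finset.prod_pow]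

end Indefinite

end Summit.HodgeConjecture.HodgeConjecture.Cruxes.HLiu418.K2LiuSiegelEisensteinKindWIndexDictionary

end
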